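import Literature.NumberTheory.LFunctions.AlcantaraBodeOperator
import Literature.NumberTheory.LFunctions.NymanBeurling
import Literature.NumberTheory.LFunctions.BeurlingClosureLpProofs
import Literature.NumberTheory.LFunctions.ZetaRealAxis
import HarnessLib

/-!
# RH-EQUIVALENT (PROVED) · Alcántara-Bode's criterion `AlcantaraBode1993_criterion` — RH iff the Hilbert–Schmidt operator `(Af)(θ) = ∫₀¹ f(x){θ/x} dx` is injective on `L²(0,1)` — DISCHARGED from the tree's Nyman–Beurling theorems; nothing here bears on the truth of RH

LABEL (line 1): an RH-EQUIVALENCE PROVED AS AN EQUIVALENCE (`AlcantaraBode1993_criterion_holds`);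
neither side is asserted. Sibling proofs file (D-0014 append protocol) of
`Literature/NumberTheory/LFunctions/AlcantaraBodeOperator.lean` (the named fact, typed by the
literature-typing tranche `rh-lit-broughan-2` from Borwein–Choi–Rooney–Weirathmueller 2008,
Equivalence 5.26; Broughan Vol. 2, Ch. 8). Nothing here bears on the truth of RH.

## The proof (both directions reduce to the tree's Nyman–Beurling theory)

* **Injective ⟹ RH** (`riemannHypothesis_of_alcantaraBode_injective`). If `ζ(s₀) = 0` with
  `1/2 < Re s₀ < 1`, then `Im s₀ ≠ 0` (no real zeros in `(0,1)`, `riemannZeta_ofReal_ne_zero_of_pos_of_lt_one`)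
  and `conj s₀` is a zero too (`riemannZeta_conj`). Beurling's Mellin identity
  `∫₀¹ x^{s−1}{θ/x} dx = θ/(s−1) − θ^s ζ(s)/s` (`0 < θ ≤ 1`, `Re s > 0`; the tree's
  `mellin_beurlingRhoTrunc_eq`) shows that the `L²(0,1)` function
  `m(x) = (s₀−1)x^{s₀−1} − (s̄₀−1)x^{s̄₀−1}` satisfies `(Am)(θ) = θ − θ = 0` for every `θ ∈ (0,1)`;
  injectivity forces `m = 0` a.e., whence `∫₀¹ m = 0`; but `∫₀¹ m = (s₀−1)/s₀ − (s̄₀−1)/s̄₀ =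
  1/s̄₀ − 1/s₀ ≠ 0`. (This two-zero functional argument replaces Alcántara-Bode's own proof, which
  is not held.)
* **RH ⟹ injective** (`alcantaraBode_injective_of_riemannHypothesis`). `θ ↦ {θ/x}` is continuous
  into `L²(0,1)` (dominated convergence: `{·}` is continuous off `ℤ`, and `{x : θ/x ∈ ℤ}` is
  countable), so `Af` is continuous on `(0,1]` and "`Af = 0` a.e." upgrades to `Af ≡ 0` on `(0,1]`.
  Then `∫₀¹ f · k_α = −(Af)(α) + α (Af)(1) = 0` for Broughan's `k_α = ⌊α/x⌋ − α⌊1/x⌋`, `0 < α ≤ 1`;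
  under RH the real span of the `k_α` is dense in real `L²(0,1)` (the tree's
  `riemannHypothesis_iff_nymanK_fundamental`, Beurling's dilation lemma), so `∫₀¹ f g = 0` for every
  real `g ∈ L²(0,1)`, and `g = Re f`, `g = Im f` give `f = 0` a.e.

## References

* [AlcantaraBode1993] J. Alcántara-Bode, *An integral equation formulation of the Riemann
  Hypothesis*, Integral Equations Operator Theory 17 (1993) 151–168, main theorem.
* [BorweinChoiRooneyWeirathmueller2008] *The Riemann Hypothesis*, CMS Books 2008, Equivalence 5.26.
* [Broughan2017] K. Broughan, *Equivalents of the Riemann Hypothesis* Vol. 2, CUP 2017, Ch. 8; Thm 3.1.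
* [Beurling1955] A. Beurling, Proc. Nat. Acad. Sci. 41 (1955) 312–314 (Mellin identity, dilation lemma).
-/

noncomputable section

open MeasureTheory Set Complex Filter Topology
open scoped ENNReal

namespace Literature.NumberTheory.LFunctions

/-! ## Beurling's Mellin identity in Alcántara-Bode's notation -/

/-- `(A x^{s−1})(θ) = ∫₀¹ x^{s−1} {θ/x} dx = θ/(s−1) − θ^s ζ(s)/s` for `0 < θ ≤ 1`, `Re s > 0`, `s ≠ 1`
(the tree's `mellin_beurlingRhoTrunc_eq` with `k = 1/θ`). [cite: Beurling1955, eq. (1) (as in Broughan2017 Vol. 2 Lemma 3.2)] -/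
theorem alcantaraBodeOp_cpow {θ : ℝ} (hθ0 : 0 < θ) (hθ1 : θ ≤ 1) {s : ℂ} (hs : 0 < s.re)
    (hs1 : s ≠ 1) :
    alcantaraBodeOp (fun x : ℝ => (x : ℂ) ^ (s - 1)) θ =
      θ / (s - 1) - (θ : ℂ) ^ s * riemannZeta s / s := by
  have hk : (1 : ℝ) ≤ 1 / θ := by rw [le_div_iff₀ hθ0]; linarith
  have hM := mellin_beurlingRhoTrunc_eq hk hs hs1
  -- the Mellin integral is Alcántara-Bode's integral
  have hlhs : mellin (beurlingRhoTrunc (1 / θ)) s =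
      alcantaraBodeOp (fun x : ℝ => (x : ℂ) ^ (s - 1)) θ := by
    unfold mellin alcantaraBodeOp beurlingRhoTrunc
    have h1 : (fun t : ℝ => (t : ℂ) ^ (s - 1) •
        (Ioc (0 : ℝ) 1).indicator (fun t : ℝ => ((Int.fract (1 / (1 / θ * t)) : ℝ) : ℂ)) t) =
        (Ioc (0 : ℝ) 1).indicator
          (fun t : ℝ => (t : ℂ) ^ (s - 1) * ((Int.fract (θ / t) : ℝ) : ℂ)) := by
      funext t
      by_cases ht : t ∈ Ioc (0 : ℝ) 1
      · have ht0 : t ≠ 0 := ht.1.ne'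
        have hθ0' : θ ≠ 0 := hθ0.ne'
        rw [indicator_of_mem ht, indicator_of_mem ht, smul_eq_mul]
        congr 3
        field_simp
      · rw [indicator_of_notMem ht, indicator_of_notMem ht, smul_zero]
    rw [h1, setIntegral_indicator measurableSet_Ioc,
      show Ioi (0 : ℝ) ∩ Ioc 0 1 = Ioc 0 1 from
        Set.inter_eq_right.2 fun x hx => hx.1,
      setIntegral_congr_set Ioo_ae_eq_Ioc.symm]
  rw [← hlhs, hM]
  have hθ : (θ : ℂ) ≠ 0 := by exact_mod_cast hθ0.ne'
  have hinv : ((1 / θ : ℝ) : ℂ) ^ (-s) = (θ : ℂ) ^ s := by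
    push_cast
    rw [one_div, inv_cpow _ _ (by
      rw [arg_ofReal_of_nonneg hθ0.le]; exact Real.pi_ne_zero.symm), cpow_neg, inv_inv]
  rw [hinv]
  push_cast
  field_simp

/-! ## Injective ⟹ RH -/

/-- `x ↦ x^{s−1}` is in `L²(0,1)` for `Re s > 1/2`. [cite: Beurling1955, proof (x^{s−1} ∈ L²(0,1) for Re s > 1/2)] -/
theorem memLp_two_cpow_Ioo {s : ℂ} (hσ : 1 / 2 < s.re) :
    MemLp (fun x : ℝ => (x : ℂ) ^ (s - 1)) 2 (volume.restrict (Ioo (0 : ℝ) 1)) := by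
  have hgm : AEStronglyMeasurable (fun x : ℝ => (x : ℂ) ^ (s - 1))
      (volume.restrict (Ioo (0 : ℝ) 1)) :=
    (Complex.measurable_ofReal.pow_const _).aestronglyMeasurable
  refine (memLp_two_iff_integrable_sq_norm hgm).2 ?_
  have hI : IntegrableOn (fun x : ℝ ↦ x ^ (2 * (s.re - 1))) (Ioo 0 1) volume := by
    have := (intervalIntegral.intervalIntegrable_rpow' (a := 0) (b := 1)
      (r := 2 * (s.re - 1)) (by linarith)).1
    exact this.mono_set Ioo_subset_Ioc_self
  refine hI.congr ?_
  filter_upwards [ae_restrict_mem measurableSet_Ioo] with x hx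
  rw [norm_cpow_eq_rpow_re_of_pos hx.1, sub_re, one_re, ← Real.rpow_natCast,
    ← Real.rpow_mul hx.1.le]
  norm_num [mul_comm]

/-- `∫₀¹ x^{s−1} dx = 1/s` for `Re s > 0`. [cite: Beurling1955, proof (Mellin transform of 𝟙_(0,1])] -/
theorem integral_cpow_Ioo_zero_one {s : ℂ} (hs : 0 < s.re) :
    ∫ x in Ioo (0 : ℝ) 1, (x : ℂ) ^ (s - 1) = 1 / s := by
  have hs0 : s ≠ 0 := fun h => by simp [h] at hs
  rw [setIntegral_congr_set Ioo_ae_eq_Ioc, ← intervalIntegral.integral_of_le zero_le_one,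
    integral_cpow (Or.inl (by simp; linarith))]
  simp only [sub_add_cancel, ofReal_one, one_cpow, ofReal_zero, zero_cpow hs0, sub_zero]

/-- **Injective ⟹ RH.** If Alcántara-Bode's operator `A` is injective on `L²(0,1)`, the Riemann
hypothesis holds (two-zero functional argument, see the module docstring).
[cite: AlcantaraBode1993, main theorem (⟸); BorweinChoiRooneyWeirathmueller2008 Equivalence 5.26] -/
theorem riemannHypothesis_of_alcantaraBode_injective
    (h : ∀ f : ℝ → ℂ, MemLp f 2 (volume.restrict (Ioo (0 : ℝ) 1)) →
      (∀ᵐ θ ∂(volume.restrict (Ioo (0 : ℝ) 1)), alcantaraBodeOp f θ = 0) →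
        f =ᵐ[volume.restrict (Ioo (0 : ℝ) 1)] 0) :
    RiemannHypothesis := by
  refine quasiRiemannHypothesis_one_half_iff_holds.1 fun s hζ hσ hσ1 ↦ ?_
  have hre : 0 < s.re := by linarith
  have hs0 : s ≠ 0 := fun h0 ↦ by simp [h0] at hre
  have hs1 : s ≠ 1 := fun h1 ↦ by simp [h1] at hσ1
  -- `Im s ≠ 0`: no real zeros in `(0,1)`
  have him : s.im ≠ 0 := by
    intro h0
    have hs' : s = ((s.re : ℝ) : ℂ) := Complex.ext (by simp) (by simp [h0])
    rw [hs'] at hζ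
    exact riemannZeta_ofReal_ne_zero_of_pos_of_lt_one s.re hre hσ1 hζ
  set s' : ℂ := (starRingEnd ℂ) s with hs'def
  have hζ' : riemannZeta s' = 0 := by rw [hs'def, riemannZeta_conj, hζ, map_zero]
  have hre' : 0 < s'.re := by simpa [hs'def] using hre
  have hσ' : 1 / 2 < s'.re := by simpa [hs'def] using hσ
  have hs'0 : s' ≠ 0 := fun h0 ↦ by simp [h0] at hre'
  have hs'1 : s' ≠ 1 := by
    intro h1
    have : s'.im = 0 := by rw [h1]; simp
    simp [hs'def] at this
    exact him this
  -- the test function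
  set m : ℝ → ℂ := fun x => (s - 1) * (x : ℂ) ^ (s - 1) - (s' - 1) * (x : ℂ) ^ (s' - 1) with hm
  have hm1 : MemLp (fun x : ℝ => (s - 1) * (x : ℂ) ^ (s - 1)) 2 (volume.restrict (Ioo (0 : ℝ) 1)) :=
    (memLp_two_cpow_Ioo hσ).const_mul _
  have hm2 : MemLp (fun x : ℝ => (s' - 1) * (x : ℂ) ^ (s' - 1)) 2
      (volume.restrict (Ioo (0 : ℝ) 1)) :=
    (memLp_two_cpow_Ioo hσ').const_mul _
  have hmL2 : MemLp m 2 (volume.restrict (Ioo (0 : ℝ) 1)) := hm1.sub hm2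
  -- integrability on `(0,1)` (finite measure, `L² ⊂ L¹`)
  have hi1 : IntegrableOn (fun x : ℝ => (x : ℂ) ^ (s - 1)) (Ioo (0 : ℝ) 1) :=
    (memLp_two_cpow_Ioo hσ).integrable one_le_two
  have hi2 : IntegrableOn (fun x : ℝ => (x : ℂ) ^ (s' - 1)) (Ioo (0 : ℝ) 1) :=
    (memLp_two_cpow_Ioo hσ').integrable one_le_two
  -- `(A m)(θ) = 0` for every `θ ∈ (0,1)`
  have hAm : ∀ θ ∈ Ioo (0 : ℝ) 1, alcantaraBodeOp m θ = 0 := by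
    intro θ hθ
    have hb : ∀ x : ℝ, ‖((Int.fract (θ / x) : ℝ) : ℂ)‖ ≤ 1 := fun x => by
      rw [Complex.norm_real, Real.norm_eq_abs, abs_of_nonneg (Int.fract_nonneg _)]
      exact (Int.fract_lt_one _).le
    have hmeasF : AEStronglyMeasurable (fun x : ℝ => ((Int.fract (θ / x) : ℝ) : ℂ))
        (volume.restrict (Ioo (0 : ℝ) 1)) :=
      (Complex.measurable_ofReal.comp (measurable_fract.comp
        (measurable_const.div measurable_id))).aestronglyMeasurable
    have hI1 : IntegrableOn (fun x : ℝ => (x : ℂ) ^ (s - 1) * ((Int.fract (θ / x) : ℝ) : ℂ))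
        (Ioo (0 : ℝ) 1) :=
      hi1.mul_bdd hmeasF (ae_of_all _ hb)
    have hI2 : IntegrableOn (fun x : ℝ => (x : ℂ) ^ (s' - 1) * ((Int.fract (θ / x) : ℝ) : ℂ))
        (Ioo (0 : ℝ) 1) :=
      hi2.mul_bdd hmeasF (ae_of_all _ hb)
    have hA1 := alcantaraBodeOp_cpow hθ.1 hθ.2.le hre hs1
    have hA2 := alcantaraBodeOp_cpow hθ.1 hθ.2.le hre' hs'1
    unfold alcantaraBodeOp at hA1 hA2 ⊢
    have hsplit : (fun x : ℝ => m x * ((Int.fract (θ / x) : ℝ) : ℂ)) = fun x : ℝ =>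
        (s - 1) * (((x : ℝ) : ℂ) ^ (s - 1) * ((Int.fract (θ / x) : ℝ) : ℂ)) -
          (s' - 1) * (((x : ℝ) : ℂ) ^ (s' - 1) * ((Int.fract (θ / x) : ℝ) : ℂ)) := by
      funext x; simp only [hm]; ring
    rw [hsplit, integral_sub (hI1.const_mul _) (hI2.const_mul _), integral_const_mul,
      integral_const_mul, hA1, hA2, hζ, hζ']
    field_simp
    ring
  -- injectivity: `m = 0` a.e., hence `∫₀¹ m = 0`
  have hm0 : m =ᵐ[volume.restrict (Ioo (0 : ℝ) 1)] 0 :=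
    h m hmL2 (by
      filter_upwards [ae_restrict_mem measurableSet_Ioo] with θ hθ
      exact hAm θ hθ)
  have hint0 : ∫ x in Ioo (0 : ℝ) 1, m x = 0 := by
    rw [integral_congr_ae hm0]
    simp
  -- but `∫₀¹ m = (s−1)/s − (s'−1)/s'`
  have hint : ∫ x in Ioo (0 : ℝ) 1, m x = (s - 1) * (1 / s) - (s' - 1) * (1 / s') := by
    simp only [hm]
    rw [integral_sub (hi1.const_mul _) (hi2.const_mul _), integral_const_mul, integral_const_mul,
      integral_cpow_Ioo_zero_one hre, integral_cpow_Ioo_zero_one hre']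
  rw [hint] at hint0
  -- `(s−1)/s − (s'−1)/s' = (s − s')/(s s') ≠ 0`
  have hss' : s - s' ≠ 0 := by
    intro h0
    have : (s - s').im = 0 := by rw [h0]; simp
    simp [hs'def] at this
    exact him this
  apply hss'
  have key : (s - 1) * (1 / s) - (s' - 1) * (1 / s') = (s - s') / (s * s') := by
    field_simp
    ring
  rw [key, div_eq_zero_iff] at hint0
  exact hint0.resolve_right (mul_ne_zero hs0 hs'0)

/-! ## RH ⟹ injective -/

/-- `(Af)(θ)` is bounded: for `f` integrable on `(0,1)` the integrand `f(x){θ/x}` is dominated by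
`‖f‖`; in particular `Af` is sequentially continuous in `θ` (dominated convergence: `{·}` is
continuous off `ℤ`, and `{x : {θ₀/x} = 0}` is countable, hence Lebesgue-null).
[cite: AlcantaraBode1993, §2 (A is a Hilbert–Schmidt, hence continuous, kernel operator)] -/
theorem tendsto_alcantaraBodeOp {f : ℝ → ℂ} (hf : IntegrableOn f (Ioo (0 : ℝ) 1)) {θ₀ : ℝ}
    (hθ : θ₀ ≠ 0) {u : ℕ → ℝ} (hu : Tendsto u atTop (𝓝 θ₀)) :
    Tendsto (fun n => alcantaraBodeOp f (u n)) atTop (𝓝 (alcantaraBodeOp f θ₀)) := by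
  unfold alcantaraBodeOp
  have hmeas : ∀ θ : ℝ, AEStronglyMeasurable (fun x : ℝ => f x * ((Int.fract (θ / x) : ℝ) : ℂ))
      (volume.restrict (Ioo (0 : ℝ) 1)) := fun θ =>
    hf.aestronglyMeasurable.mul (Complex.measurable_ofReal.comp (measurable_fract.comp
      (measurable_const.div measurable_id))).aestronglyMeasurable
  refine tendsto_integral_of_dominated_convergence (fun x => ‖f x‖) (fun n => hmeas (u n))
    hf.norm ?_ ?_
  · intro n
    refine ae_of_all _ fun x => ?_
    rw [norm_mul, Complex.norm_real, Real.norm_eq_abs, abs_of_nonneg (Int.fract_nonneg _)]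
    calc ‖f x‖ * Int.fract (u n / x) ≤ ‖f x‖ * 1 := by
          gcongr; exact (Int.fract_lt_one _).le
      _ = ‖f x‖ := mul_one _
  · -- off the countable set where `θ₀/x ∈ ℤ`, `θ ↦ {θ/x}` is continuous at `θ₀`
    have hc : ({x : ℝ | Int.fract (θ₀ / x) = 0}).Countable := by
      refine (Set.countable_range (fun n : ℤ => θ₀ / (n : ℝ))).mono fun x hx => ?_
      have hx' : θ₀ / x = (⌊θ₀ / x⌋ : ℝ) := by
        have := Int.floor_add_fract (θ₀ / x)
        rw [hx, add_zero] at this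
        exact this.symm
      by_cases hx0 : x = 0
      · exact ⟨0, by simp [hx0]⟩
      · refine ⟨⌊θ₀ / x⌋, ?_⟩
        have hn0 : (⌊θ₀ / x⌋ : ℝ) ≠ 0 := by
          rw [← hx']; exact div_ne_zero hθ hx0
        have hmul : θ₀ = (⌊θ₀ / x⌋ : ℝ) * x := (div_eq_iff hx0).1 hx'
        show θ₀ / (⌊θ₀ / x⌋ : ℝ) = x
        rw [div_eq_iff hn0]
        linarith [mul_comm ((⌊θ₀ / x⌋ : ℤ) : ℝ) x]
    have hnull : ∀ᵐ x ∂(volume.restrict (Ioo (0 : ℝ) 1)), Int.fract (θ₀ / x) ≠ 0 :=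
      ae_restrict_of_ae ((measure_eq_zero_iff_ae_notMem (s := {x : ℝ | Int.fract (θ₀ / x) = 0})).1
        (hc.measure_zero volume))
    filter_upwards [hnull] with x hx
    have hcont : ContinuousAt Int.fract (θ₀ / x) := by
      refine continuousAt_fract fun h => hx ?_
      rw [h, Int.fract_intCast]
    have h1 : Tendsto (fun n => u n / x) atTop (𝓝 (θ₀ / x)) := hu.div_const x
    have h2 : Tendsto (fun n => ((Int.fract (u n / x) : ℝ) : ℂ)) atTop
        (𝓝 (((Int.fract (θ₀ / x) : ℝ) : ℂ))) :=
      (Complex.continuous_ofReal.tendsto _).comp (hcont.tendsto.comp h1)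
    exact tendsto_const_nhds.mul h2

/-- If `Af = 0` a.e. on `(0,1)` then `(Af)(θ₀) = 0` for every `θ₀ ∈ (0,1]` (density of the zero set
plus continuity from the left). [cite: AlcantaraBode1993, §2 (continuity of Af)] -/
theorem alcantaraBodeOp_eq_zero_of_ae {f : ℝ → ℂ} (hf : IntegrableOn f (Ioo (0 : ℝ) 1))
    (h : ∀ᵐ θ ∂(volume.restrict (Ioo (0 : ℝ) 1)), alcantaraBodeOp f θ = 0) {θ₀ : ℝ}
    (h0 : 0 < θ₀) (h1 : θ₀ ≤ 1) : alcantaraBodeOp f θ₀ = 0 := by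
  have hmeas0 : (volume.restrict (Ioo (0 : ℝ) 1)) {θ | ¬alcantaraBodeOp f θ = 0} = 0 := ae_iff.1 h
  have hex : ∀ n : ℕ, ∃ θ ∈ Ioo (max (θ₀ / 2) (θ₀ - 1 / ((n : ℝ) + 1))) θ₀,
      alcantaraBodeOp f θ = 0 := by
    intro n
    by_contra hne
    have hne' : ∀ θ ∈ Ioo (max (θ₀ / 2) (θ₀ - 1 / ((n : ℝ) + 1))) θ₀, alcantaraBodeOp f θ ≠ 0 :=
      fun θ hθ hz => hne ⟨θ, hθ, hz⟩
    set a : ℝ := max (θ₀ / 2) (θ₀ - 1 / ((n : ℝ) + 1)) with ha_def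
    have hpos : (0 : ℝ) < 1 / ((n : ℝ) + 1) := by positivity
    have ha : a < θ₀ := max_lt (by linarith) (by linarith)
    have ha0 : 0 < a := lt_of_lt_of_le (by linarith) (le_max_left _ _)
    have hsub : Ioo a θ₀ ⊆ {θ | ¬alcantaraBodeOp f θ = 0} := fun θ hθ => (hne' θ hθ)
    have hIoo : Ioo a θ₀ ⊆ Ioo (0 : ℝ) 1 := fun θ hθ => ⟨ha0.trans hθ.1, lt_of_lt_of_le hθ.2 h1⟩
    have hz : (volume.restrict (Ioo (0 : ℝ) 1)) (Ioo a θ₀) = 0 := measure_mono_null hsub hmeas0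
    rw [Measure.restrict_apply measurableSet_Ioo, Set.inter_eq_left.2 hIoo, Real.volume_Ioo,
      ENNReal.ofReal_eq_zero] at hz
    linarith
  choose u hu using hex
  have hlim : Tendsto u atTop (𝓝 θ₀) := by
    have hlow : Tendsto (fun n : ℕ => θ₀ - 1 / ((n : ℝ) + 1)) atTop (𝓝 θ₀) := by
      have := (tendsto_one_div_add_atTop_nhds_zero_nat (𝕜 := ℝ))
      simpa using (tendsto_const_nhds (x := θ₀)).sub this
    refine tendsto_of_tendsto_of_tendsto_of_le_of_le hlow tendsto_const_nhds (fun n => ?_)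
      (fun n => (hu n).1.2.le)
    exact ((le_max_right _ _).trans_lt (hu n).1.1).le
  have hcont := tendsto_alcantaraBodeOp hf h0.ne' hlim
  have hzero : (fun n => alcantaraBodeOp f (u n)) = fun _ => (0 : ℂ) := funext fun n => (hu n).2
  rw [hzero] at hcont
  exact tendsto_nhds_unique hcont tendsto_const_nhds

/-- The pairing of `f` with Broughan's `k_α` is a combination of values of `Af`:
`∫₀¹ f k_α = −(Af)(α) + α (Af)(1)`. [cite: Broughan2017, Vol. 2 Thm 3.1 (3.1) (k_α = ⌊α/x⌋ − α⌊1/x⌋)] -/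
theorem integral_mul_nymanK_eq {f : ℝ → ℂ} (hf : IntegrableOn f (Ioo (0 : ℝ) 1)) (α : ℝ) :
    ∫ x in Ioo (0 : ℝ) 1, f x * (nymanK α x : ℂ) =
      -alcantaraBodeOp f α + α * alcantaraBodeOp f 1 := by
  have hb : ∀ (β : ℝ) (x : ℝ), ‖((Int.fract (β / x) : ℝ) : ℂ)‖ ≤ 1 := fun β x => by
    rw [Complex.norm_real, Real.norm_eq_abs, abs_of_nonneg (Int.fract_nonneg _)]
    exact (Int.fract_lt_one _).le
  have hmeasF : ∀ β : ℝ, AEStronglyMeasurable (fun x : ℝ => ((Int.fract (β / x) : ℝ) : ℂ))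
      (volume.restrict (Ioo (0 : ℝ) 1)) := fun β =>
    (Complex.measurable_ofReal.comp (measurable_fract.comp
      (measurable_const.div measurable_id))).aestronglyMeasurable
  have i1 : IntegrableOn (fun x : ℝ => f x * ((Int.fract (α / x) : ℝ) : ℂ)) (Ioo (0 : ℝ) 1) :=
    hf.mul_bdd (hmeasF α) (ae_of_all _ (hb α))
  have i2 : IntegrableOn (fun x : ℝ => f x * ((Int.fract (1 / x) : ℝ) : ℂ)) (Ioo (0 : ℝ) 1) :=
    hf.mul_bdd (hmeasF 1) (ae_of_all _ (hb 1))
  have e : (fun x : ℝ => f x * (nymanK α x : ℂ)) = fun x =>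
      (α : ℂ) * (f x * ((Int.fract (1 / x) : ℝ) : ℂ)) - f x * ((Int.fract (α / x) : ℝ) : ℂ) := by
    funext x
    rw [nymanK_eq]
    push_cast
    ring
  unfold alcantaraBodeOp
  rw [e, integral_sub (i2.const_mul _) i1, integral_const_mul]
  ring

/-- **RH ⟹ injective.** Under RH, Alcántara-Bode's operator is injective on `L²(0,1)`: if
`Af = 0` a.e. then `f = 0` a.e. [cite: AlcantaraBode1993, main theorem (⟹); BorweinChoiRooneyWeirathmueller2008 Equivalence 5.26] -/
theorem alcantaraBode_injective_of_riemannHypothesis (hRH : RiemannHypothesis) {f : ℝ → ℂ}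
    (hf : MemLp f 2 (volume.restrict (Ioo (0 : ℝ) 1)))
    (h : ∀ᵐ θ ∂(volume.restrict (Ioo (0 : ℝ) 1)), alcantaraBodeOp f θ = 0) :
    f =ᵐ[volume.restrict (Ioo (0 : ℝ) 1)] 0 := by
  have hfi : IntegrableOn f (Ioo (0 : ℝ) 1) := hf.integrable one_le_two
  have hA : ∀ θ : ℝ, 0 < θ → θ ≤ 1 → alcantaraBodeOp f θ = 0 := fun θ h0 h1 =>
    alcantaraBodeOp_eq_zero_of_ae hfi h h0 h1
  -- (1) the pairing with every `k_α`, `0 < α ≤ 1`, vanishes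
  have hk : ∀ α : ℝ, 0 < α ∧ α ≤ 1 → ∫ x in Ioo (0 : ℝ) 1, f x * (nymanK α x : ℂ) = 0 := by
    intro α hα
    rw [integral_mul_nymanK_eq hfi, hA α hα.1 hα.2, hA 1 one_pos le_rfl]
    simp
  -- bounded measurable functions are integrable against `f`
  have hnymanK_bdd : ∀ (α : ℝ) (x : ℝ), 0 < α ∧ α ≤ 1 → ‖nymanK α x‖ ≤ 2 := by
    intro α x hα
    rw [nymanK_eq, Real.norm_eq_abs, abs_neg]
    have h1 : |Int.fract (α / x)| ≤ 1 := by
      rw [abs_of_nonneg (Int.fract_nonneg _)]; exact (Int.fract_lt_one _).le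
    have h2 : |α * Int.fract (1 / x)| ≤ 1 := by
      rw [abs_mul, abs_of_pos hα.1, abs_of_nonneg (Int.fract_nonneg _)]
      calc α * Int.fract (1 / x) ≤ 1 * 1 :=
            mul_le_mul hα.2 (Int.fract_lt_one _).le (Int.fract_nonneg _) zero_le_one
        _ = 1 := one_mul 1
    calc |Int.fract (α / x) - α * Int.fract (1 / x)| ≤ |Int.fract (α / x)| + |α * Int.fract (1 / x)| :=
          abs_sub _ _
      _ ≤ 1 + 1 := add_le_add h1 h2
      _ = 2 := by norm_num
  -- (2) the pairing with every finite real combination vanishes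
  have hK : ∀ {n : ℕ} (α c : Fin n → ℝ), (∀ i, 0 < α i ∧ α i ≤ 1) →
      ∫ x in Ioo (0 : ℝ) 1, f x * ((∑ i, c i * nymanK (α i) x : ℝ) : ℂ) = 0 := by
    intro n α c hα
    have hint : ∀ i, IntegrableOn (fun x : ℝ => f x * (nymanK (α i) x : ℂ)) (Ioo (0 : ℝ) 1) :=
      fun i => hfi.mul_bdd ((Complex.measurable_ofReal.comp
        (measurable_nymanK (α i))).aestronglyMeasurable)
        (ae_of_all _ fun x => by rw [Complex.norm_real]; exact hnymanK_bdd (α i) x (hα i))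
    have e : (fun x : ℝ => f x * ((∑ i, c i * nymanK (α i) x : ℝ) : ℂ)) =
        fun x => ∑ i, (c i : ℂ) * (f x * (nymanK (α i) x : ℂ)) := by
      funext x
      push_cast
      rw [Finset.mul_sum]
      exact Finset.sum_congr rfl fun i _ => by ring
    rw [e, integral_finsetSum _ fun i _ => (hint i).const_mul _]
    refine Finset.sum_eq_zero fun i _ => ?_
    rw [integral_const_mul, hk (α i) (hα i), mul_zero]
  -- (3) density under RH: the pairing with every real `g ∈ L²(0,1)` vanishes
  have hone : KApprox 2 (fun _ : ℝ => (1 : ℝ)) := riemannHypothesis_iff_one_mem_closure_nymanK.1 hRH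
  have hfg : ∀ g : ℝ → ℝ, MemLp g 2 (volume.restrict (Ioo (0 : ℝ) 1)) →
      ∫ x in Ioo (0 : ℝ) 1, f x * (g x : ℂ) = 0 := by
    intro g hg
    have happrox := KApprox.of_memLp (p := 2) (by norm_num) ENNReal.ofNat_ne_top hone hg
    by_contra hne
    set I : ℂ := ∫ x in Ioo (0 : ℝ) 1, f x * (g x : ℂ) with hI
    have hIpos : 0 < ‖I‖ := norm_pos_iff.2 hne
    set Cf : ℝ := (∫ x in Ioo (0 : ℝ) 1, ‖f x‖ ^ (2 : ℝ)) ^ (1 / (2 : ℝ)) with hCf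
    have hCf0 : 0 ≤ Cf := by positivity
    obtain ⟨n, α, c, hα, hlt⟩ := happrox (‖I‖ / (Cf + 1)) (by positivity)
    set K : ℝ → ℝ := fun x => ∑ i, c i * nymanK (α i) x with hKdef
    have hKm : Measurable K := measurable_nymanK_sum α c
    have hKbdd : ∀ x, ‖K x‖ ≤ ∑ i, ‖c i‖ * 2 := by
      intro x
      refine (norm_sum_le _ _).trans (Finset.sum_le_sum fun i _ => ?_)
      rw [norm_mul]
      exact mul_le_mul_of_nonneg_left (hnymanK_bdd (α i) x (hα i)) (norm_nonneg _)
    have hKL2 : MemLp K 2 (volume.restrict (Ioo (0 : ℝ) 1)) :=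
      MemLp.of_bound hKm.aestronglyMeasurable _ (ae_of_all _ hKbdd)
    have hgK : MemLp (fun x => g x - K x) 2 (volume.restrict (Ioo (0 : ℝ) 1)) := hg.sub hKL2
    -- `I = ∫ f (g − K)`
    have hfg_int : IntegrableOn (fun x : ℝ => f x * (g x : ℂ)) (Ioo (0 : ℝ) 1) := by
      have := (hg.ofReal (K := ℂ))
      exact (MemLp.integrable_mul hf this : _)
    have hfK_int : IntegrableOn (fun x : ℝ => f x * (K x : ℂ)) (Ioo (0 : ℝ) 1) :=
      hfi.mul_bdd ((Complex.measurable_ofReal.comp hKm).aestronglyMeasurable)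
        (ae_of_all _ fun x => by rw [Complex.norm_real]; exact hKbdd x)
    have hIeq : I = ∫ x in Ioo (0 : ℝ) 1, f x * ((g x - K x : ℝ) : ℂ) := by
      have e : (fun x : ℝ => f x * ((g x - K x : ℝ) : ℂ)) =
          fun x => f x * (g x : ℂ) - f x * (K x : ℂ) := by
        funext x; push_cast; ring
      rw [e, integral_sub hfg_int hfK_int, hK α c hα, sub_zero]
    -- Hölder (Cauchy–Schwarz)
    have hf2 : MemLp f (ENNReal.ofReal 2) (volume.restrict (Ioo (0 : ℝ) 1)) := by
      simpa using hf
    have hgK2 : MemLp (fun x : ℝ => ((g x - K x : ℝ) : ℂ)) (ENNReal.ofReal 2)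
        (volume.restrict (Ioo (0 : ℝ) 1)) := by
      simpa using hgK.ofReal (K := ℂ)
    have hH := integral_mul_norm_le_Lp_mul_Lq Real.HolderConjugate.two_two hf2 hgK2
    have hnormI : ‖I‖ ≤ Cf * (∫ x in Ioo (0 : ℝ) 1, ‖g x - K x‖ ^ (2 : ℝ)) ^ (1 / (2 : ℝ)) := by
      rw [hIeq]
      refine (norm_integral_le_integral_norm _).trans ?_
      have e : (fun x : ℝ => ‖f x * ((g x - K x : ℝ) : ℂ)‖) =
          fun x => ‖f x‖ * ‖((g x - K x : ℝ) : ℂ)‖ := funext fun x => norm_mul _ _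
      rw [e]
      refine hH.trans_eq ?_
      simp only [hCf, Complex.norm_real]
    -- the `L²` distance is `< ‖I‖/(Cf+1)`
    have hε : (∫ x in Ioo (0 : ℝ) 1, ‖g x - K x‖ ^ (2 : ℝ)) ^ (1 / (2 : ℝ)) < ‖I‖ / (Cf + 1) := by
      have := hgK.eLpNorm_eq_integral_rpow_norm two_ne_zero ENNReal.ofNat_ne_top
      rw [this, ENNReal.ofReal_lt_ofReal_iff (by positivity)] at hlt
      simpa [one_div] using hlt
    -- contradiction
    have h3 : ‖I‖ < ‖I‖ := by
      calc ‖I‖ ≤ Cf * (∫ x in Ioo (0 : ℝ) 1, ‖g x - K x‖ ^ (2 : ℝ)) ^ (1 / (2 : ℝ)) := hnormI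
        _ ≤ Cf * (‖I‖ / (Cf + 1)) := by gcongr
        _ < (Cf + 1) * (‖I‖ / (Cf + 1)) := by
            apply mul_lt_mul_of_pos_right (by linarith) (by positivity)
        _ = ‖I‖ := by field_simp
    exact lt_irrefl _ h3
  -- (4) conclude with `g = Re f` and `g = Im f`
  have hre := hfg _ hf.re
  have him := hfg _ hf.im
  have hi_re : IntegrableOn (fun x : ℝ => f x * ((RCLike.re (f x) : ℝ) : ℂ)) (Ioo (0 : ℝ) 1) :=
    MemLp.integrable_mul hf (hf.re.ofReal (K := ℂ))
  have hi_im : IntegrableOn (fun x : ℝ => f x * ((RCLike.im (f x) : ℝ) : ℂ)) (Ioo (0 : ℝ) 1) :=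
    MemLp.integrable_mul hf (hf.im.ofReal (K := ℂ))
  have key1 := integral_re hi_re
  rw [hre, map_zero] at key1
  have key2 := integral_im hi_im
  rw [him, map_zero] at key2
  have h1 : ∫ x in Ioo (0 : ℝ) 1, RCLike.re (f x) * RCLike.re (f x) = 0 := by
    refine Eq.trans (setIntegral_congr_fun measurableSet_Ioo fun x _ => ?_) key1
    simp
  have h2 : ∫ x in Ioo (0 : ℝ) 1, RCLike.im (f x) * RCLike.im (f x) = 0 := by
    refine Eq.trans (setIntegral_congr_fun measurableSet_Ioo fun x _ => ?_) key2
    simp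
  have hsq_re : IntegrableOn (fun x : ℝ => RCLike.re (f x) * RCLike.re (f x)) (Ioo (0 : ℝ) 1) :=
    MemLp.integrable_mul hf.re hf.re
  have hsq_im : IntegrableOn (fun x : ℝ => RCLike.im (f x) * RCLike.im (f x)) (Ioo (0 : ℝ) 1) :=
    MemLp.integrable_mul hf.im hf.im
  have hre0 : (fun x : ℝ => RCLike.re (f x) * RCLike.re (f x)) =ᵐ[volume.restrict (Ioo (0 : ℝ) 1)] 0 :=
    (integral_eq_zero_iff_of_nonneg (fun x => mul_self_nonneg _) hsq_re).1 h1
  have him0 : (fun x : ℝ => RCLike.im (f x) * RCLike.im (f x)) =ᵐ[volume.restrict (Ioo (0 : ℝ) 1)] 0 :=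
    (integral_eq_zero_iff_of_nonneg (fun x => mul_self_nonneg _) hsq_im).1 h2
  filter_upwards [hre0, him0] with x hx1 hx2
  have e1 : RCLike.re (f x) = 0 := mul_self_eq_zero.1 hx1
  have e2 : RCLike.im (f x) = 0 := mul_self_eq_zero.1 hx2
  exact Complex.ext (by simpa using e1) (by simpa using e2)

/-- DISCHARGE of `AlcantaraBode1993_criterion`: **Alcántara-Bode's criterion holds** — RH iff the
Hilbert–Schmidt operator `(Af)(θ) = ∫₀¹ f(x){θ/x} dx` is injective on `L²(0,1)` — proved as an
equivalence (neither side asserted). [cite: AlcantaraBode1993, main theorem; BorweinChoiRooneyWeirathmueller2008 Equivalence 5.26] [cite: Broughan2017, Vol. 2 Ch. 8] -/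
theorem AlcantaraBode1993_criterion_holds : AlcantaraBode1993_criterion :=
  ⟨fun hRH _ hf h => alcantaraBode_injective_of_riemannHypothesis hRH hf h,
    riemannHypothesis_of_alcantaraBode_injective⟩

end Literature.NumberTheory.LFunctions
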